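import Summits.ResolutionOfSingularities.ResolutionOfSingularities.Theorems.UniformComplexityCampaignW82TwistNormalRegular
import Summits.ResolutionOfSingularities.ResolutionOfSingularities.Theorems.UniformComplexityCampaignW82TwistExponentUnbounded
import Literature.AlgebraicGeometry.Resolution.RegularLocalRingsNormal
import HarnessLib

/-!
# [OURS · L1 W8.2] «NORMALISING THE FROBENIUS TWISTS NEVER SUFFICES», in the residual's own shape over `M(t)`

Cell `res-hironaka` (run/shared/lean/pub/res-hironaka/), LADDER-RESOLUTION rung L (RESCUE), slot W8.2 of
plan/RESCUE-SEED.md, door 2 = route `UniformComplexity`, host item `PrimeModelTransfer`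
(stmt-ResolutionOfSingularities-8933); prover res-L1-s82-pv-2 (gen 4). THESES-FREE module (imports the gen-4 siblings
`…TwistNormalRegular` (`isRegular_surf`) and, through it, `…TwistNormal` (`no_smooth_finite_model_twist`,
`not_smooth_surfTo`, `integralOverPerfectClosure_surf`, `hasSmoothFrobeniusTwistModel_surf`, …); the gen-3
`…TwistExponentUnbounded` (`irreducible_X_pow_sub_C_ratFuncX`: `X^p − t` is irreducible over `M(t)`); the Literature
file `Resolution.RegularLocalRingsNormal` (Matsumura 19.4: `isIntegrallyClosed_of_isRegularLocalRing`); Mathlib;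
`HarnessLib`).

[OURS · L1 W8.2] replaces the role of no printed item; NOT a statement of H. Hironaka's manuscript. The (s2)/N3 rung
of Cruxes/PrimeFieldToPerfect/Disproof.lean («NORMALISE the twists, never re-resolve» is false from dimension 2),
kernel-checked for EVERY prime `p` and every constant field `M`, stated against the hypothesis block of the lane-signed
REGULAR normal form of the slot's residual (`CampaignW82.FrobeniusTwistStepRegularAt p M n`, p485672):

* `no_smooth_finite_model_surf` / `no_smooth_finite_model_twist_zero` — level `0`: for `X^p − t` irreducible, no
  FINITE birational modification of the regular surface `Y_t : x^p − t = yz` (from an integral scheme) is smooth over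
  `K` (regular ⇒ normal ⇒ the modification is an isomorphism; `Y_t` is not smooth);
* **`normalisation_never_suffices p M`**: there is `f₀ : X₀ ⟶ Spec M(t)` — separated, of finite type, `dim X₀ ≤ 2`,
  `IntegralOverPerfectClosure`, `IsIntegral X₀`, `Scheme.IsRegular X₀`, `¬ Smooth f₀` (namely `Y_t`, `t = RatFunc.X`)
  — which HAS a smooth proper birational model of some Frobenius twist granted FACT-LIST F-02 (`CossartPiltant2019`,
  through res-L1-s82-pv-1's dimension-`≤ 3` rung), but such that for NO level `m ≥ 0` is ANY FINITE birational
  modification of `X₀ ×_{M(t),Frob^m} M(t)` from an integral scheme smooth over `M(t)`.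

Reading: restricted to finite modifications `π` (normalisation, identity, …) the conclusion of the residual FAILS in
dimension `2` at every level; the `∃`-model must RESOLVE the twisted level (an `A_{p−1}` point here). With the gen-3/4
curve rungs (`frobeniusTwist_exponent_unbounded(_regular)`: the level is unbounded) this pins the shape of any proof
of the open grades: an `X₀`-dependent level AND a resolution there.

HONEST FRAMING. OURS bookkeeping about an OURS statement; classical mathematics; NOT a statement of H. Hironaka's 2017
manuscript ([Hironaka2017]); nothing is attributed to its author. It says nothing about the open grades `n ≥ 4`
beyond the mechanism constraint. AI work, weaker than expert review. No `sorry`, no new axioms.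

## References (vocabulary and locators only)
* N. Shepherd-Barron, arXiv:1711.10439, Remark 2(1). Zs. Patakfalvi–J. Waldron, arXiv:1708.04268, §2.4.
* H. Matsumura, *Commutative Ring Theory* (1986), Thm. 19.4. [Matsumura1987]
* Cruxes/PrimeFieldToPerfect/Disproof.lean §4 (s2); Cruxes/PrimeModelTransfer/STRATEGY-CENSUS.md N3;
  L/res-L1-s82-pv-2/NOTES.md (gen 4).
-/

noncomputable section

set_option linter.dupNamespace false -- mandated namespace of this single-conjunct summit

open Polynomial IsLocalRing
open _root_.CategoryTheory _root_.CategoryTheory.Limits _root_.AlgebraicGeometry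

namespace Summit.ResolutionOfSingularities.ResolutionOfSingularities.Theorems.CampaignW82.TwistNormal

open Literature.AlgebraicGeometry.Resolution

/-! ## §13 Level `0`, and the rung in the residual's own shape over `M(t)` (all levels `m ≥ 0`) -/

section Packaged

variable (K : Type) [Field K] (p : ℕ) [hp : Fact p.Prime] [CharP K p] (t : K)

/-- **Level `0`**: for `X^p − t` irreducible, NO FINITE birational modification of `Y_t` itself from an integral
scheme is smooth over `K` — `Y_t` is regular (`isRegular_surf`), hence normal (Matsumura 19.4, tree
`isIntegrallyClosed_of_isRegularLocalRing`), so the modification is an isomorphism, and `Y_t` is not smooth.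
[folklore] -/
theorem no_smooth_finite_model_surf (ht : Irreducible (X ^ p - C t : K[X])) (Y' : Scheme.{0}) [IsIntegral Y']
    (ν : Y' ⟶ surf K p t) [IsFinite ν] (hν : IsBirational ν) (hsm : Smooth (ν ≫ surfTo K p t)) : False := by
  haveI := isIntegral_surf K p t
  have hnorm : ∀ y : ↥(surf K p t), IsIntegrallyClosed ((surf K p t).presheaf.stalk y) := fun y =>
    haveI := isRegular_surf K p t ht y
    isIntegrallyClosed_of_isRegularLocalRing _
  haveI : IsIso ν := isIso_of_isFinite_of_isBirational ν hnorm hν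
  have h := MorphismProperty.RespectsIso.precomp (P := @Smooth) (inv ν) _ hsm
  rw [IsIso.inv_hom_id_assoc] at h
  exact not_smooth_surfTo K p t h

/-- **Level `0` in twist form** (base change along `Frob^0 = id`). [folklore] -/
theorem no_smooth_finite_model_twist_zero (ht : Irreducible (X ^ p - C t : K[X])) (Y' : Scheme.{0}) [IsIntegral Y']
    (ν : Y' ⟶ pullback (surfTo K p t) (Spec.map (CommRingCat.ofHom (iterateFrobenius K p 0))))
    [IsFinite ν] (hν : IsBirational ν)
    (hsm : Smooth (ν ≫ pullback.snd (surfTo K p t) (Spec.map (CommRingCat.ofHom (iterateFrobenius K p 0))))) :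
    False := by
  have ht' : Irreducible (X ^ p - C (iterateFrobenius K p 0 t) : K[X]) := by
    rw [iterateFrobenius_zero_apply]; exact ht
  let e := baseChangeIso K p t (iterateFrobenius K p 0)
  haveI := isIntegral_surf K p (iterateFrobenius K p 0 t)
  haveI : IsIntegral (pullback (surfTo K p t) (Spec.map (CommRingCat.ofHom (iterateFrobenius K p 0)))) :=
    IsIntegral.of_isIso e.inv
  have hnorm : ∀ y : ↥(pullback (surfTo K p t) (Spec.map (CommRingCat.ofHom (iterateFrobenius K p 0)))),
      IsIntegrallyClosed
        ((pullback (surfTo K p t) (Spec.map (CommRingCat.ofHom (iterateFrobenius K p 0)))).presheaf.stalk y) := by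
    intro y
    haveI := isRegular_surf K p (iterateFrobenius K p 0 t) ht' (e.hom.base y)
    haveI := isIntegrallyClosed_of_isRegularLocalRing ((surf K p (iterateFrobenius K p 0 t)).presheaf.stalk (e.hom.base y))
    exact IsIntegrallyClosed.of_equiv (asIso (e.hom.stalkMap y)).commRingCatIsoToRingEquiv
  haveI : IsIso ν := isIso_of_isFinite_of_isBirational ν hnorm hν
  have h := MorphismProperty.RespectsIso.precomp (P := @Smooth) (inv ν) _ hsm
  rw [IsIso.inv_hom_id_assoc] at h
  have h2 := MorphismProperty.RespectsIso.precomp (P := @Smooth) e.inv _ h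
  rw [← baseChangeIso_hom_comp K p t (iterateFrobenius K p 0), Iso.inv_hom_id_assoc] at h2
  exact not_smooth_surfTo K p (iterateFrobenius K p 0 t) h2

/-- **[OURS · L1 W8.2] «NORMALISING THE TWISTS NEVER SUFFICES», IN THE RESIDUAL'S OWN SHAPE.** For every prime `p`
and EVERY field `M` of characteristic `p` (door 1: `M` perfect; door 2: `M` algebraically closed) there is a
separated finite-type `f₀ : X₀ ⟶ Spec M(t)` of dimension `≤ 2` which is INTEGRAL, REGULAR, integral over the
perfect closure and NOT smooth — namely the surface `Y : x^p − t = yz` — such that: it HAS a smooth proper birational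
model of some Frobenius twist (given FACT-LIST F-02, through the dimension-`≤ 3` rung), but for NO level `m ≥ 0` is
any FINITE birational modification (normalisation, identity, …) of the twist `X₀ ×_{K,Frob^m} K` smooth over
`K = M(t)`. So the `∃`-model of the lane-signed normal form `CampaignW82.FrobeniusTwistStepRegularAt p M n` (`n ≥ 2`)
must come from a RESOLUTION of the twisted level; «twist, then normalise» — which proves the curve case — is dead
from dimension `2`. Replaces the role of no printed item; NOT a statement of H. Hironaka's manuscript. [folklore] -/
theorem normalisation_never_suffices (M : Type) [Field M] [CharP M p] :
    ∃ (X₀ : Scheme.{0}) (f₀ : X₀ ⟶ Spec (.of (RatFunc M))),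
      IsSeparated f₀ ∧ LocallyOfFiniteType f₀ ∧ QuasiCompact f₀ ∧ topologicalKrullDim X₀ ≤ 2 ∧
      IntegralOverPerfectClosure (RatFunc M) f₀ ∧ IsIntegral X₀ ∧ Scheme.IsRegular X₀ ∧ ¬ Smooth f₀ ∧
      (CossartPiltant2019.{0} → HasSmoothFrobeniusTwistModel p (RatFunc M) f₀) ∧
      ∀ (m : ℕ) (Y' : Scheme.{0})
        (ν : Y' ⟶ pullback f₀ (Spec.map (CommRingCat.ofHom (iterateFrobenius (RatFunc M) p m)))),
        IsIntegral Y' → IsFinite ν → IsBirational ν →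
          ¬ Smooth (ν ≫ pullback.snd f₀ (Spec.map (CommRingCat.ofHom (iterateFrobenius (RatFunc M) p m)))) := by
  have ht : Irreducible (X ^ p - C (RatFunc.X : RatFunc M)) := TwistExponent.irreducible_X_pow_sub_C_ratFuncX p M
  refine ⟨surf (RatFunc M) p RatFunc.X, surfTo (RatFunc M) p RatFunc.X, inferInstance,
    locallyOfFiniteType_surfTo (RatFunc M) p RatFunc.X, inferInstance,
    topologicalKrullDim_surf_le_two (RatFunc M) p RatFunc.X hp.out.ne_zero,
    integralOverPerfectClosure_surf (RatFunc M) p RatFunc.X, isIntegral_surf (RatFunc M) p RatFunc.X,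
    isRegular_surf (RatFunc M) p RatFunc.X ht, not_smooth_surfTo (RatFunc M) p RatFunc.X,
    fun hCP => hasSmoothFrobeniusTwistModel_surf (RatFunc M) p RatFunc.X hCP, ?_⟩
  intro m Y' ν hY' hν hbir hsm
  cases m with
  | zero => exact no_smooth_finite_model_twist_zero (RatFunc M) p RatFunc.X ht Y' ν hbir hsm
  | succ k => exact no_smooth_finite_model_twist (RatFunc M) p RatFunc.X k Y' ν hbir hsm

end Packaged

end Summit.ResolutionOfSingularities.ResolutionOfSingularities.Theorems.CampaignW82.TwistNormal

end
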